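import Literature.Dynamics.Billiards.URegularState
import Literature.Analysis.FluidPDE.InfiniteHardSphereDynamics
import Literature.Analysis.FluidPDE.HardSphereRegularGeometry
import HarnessLib

/-!
# Unstable plaques of the infinite hard-sphere flow (finite windows, exterior held to its
# backward data) and the plaque functor of route UGibbsSRBRigidity

Topic `Literature/Dynamics/Billiards`; definition item `defn-InfiniteUnstablePlaques` (request D4 of
route `Summits/AtomisticToContinuum/HydrodynamicLimit/Theses/UGibbsSRBRigidity.lean`; consumers: crux
URegularLimitsR (stmt-AtomisticToContinuum-13798, clause (iv) `(L 1 Φ∞).IsURegular μ`), crux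
URigidity (stmt-AtomisticToContinuum-9711, hypothesis), and the route's kill-criterion object).
This is the infinite-volume half deferred by `Literature.Dynamics.Billiards.URegularState` ("the
route's `…Defs.lean` only has to supply its plaque family on `PointConfig`"): a ROUTE-POSITED
object — no published source defines unstable manifolds of the infinite hard-sphere flow — built
here with real content and shipped with the structural lemmas that separate it from the vacuous
choices found by the refuters of stmt-9710/9711 (Dirac leaves, zero leaves, `univ`/reference law,
void/point families).

## Contents

1. **Time reversal** `revPhase (q, v) = (q, -v)`, `reversePath γ s = R (γ (-s))`.
2. **Window dynamics in a prescribed moving environment** `IsWindowTrajectory ε W S z`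
   (reversed time `s ≥ 0`): the particles labelled by `W` move by free flight and elastic
   contacts, every other label of `S` being a prescribed mover; ONE-SIDED collision law (only the
   window particle's outgoing velocity is prescribed, by `(reflectVel n (v_p, v_q)).1`);
   LEFT-continuous velocities, free flight anchored at right endpoints. `gluePaths` glues window
   paths with environment paths.
3. **Windows and implanting**: `windowLabels Λ ω` (the particles of `ω` with position in `Λ`, a
   `Finset`), `implant Λ ω y = (ω ∩ (Λᶜ × ℝ^d)) ∪ {y i}` (replace the window particles, keep the
   exterior), `revTraj Φ ω q` (reversed recorded path of particle `q` under the flow `Φ`).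
4. **Unstable sets and leaf measures of a window**: `windowUnstableSet Φ Λ ω` — for GOOD `ω`, the
   configurations `implant Λ ω (R ∘ x · 0)` where `x` is a window trajectory in the environment
   `revTraj Φ ω` (exterior held to its reversed recorded paths) converging exponentially, particle
   by particle in phase space, to the reversed recorded window paths (Ledrappier–Young (1.2) for
   the window system); `windowLocalUnstableSet Φ Λ δ ω` (moreover `δ`-close at all `s ≥ 0`);
   `windowUnstableDim d k = d·k` and `windowLeafMeasure Φ Λ ω` = push-forward under `implant` of
   the `dk`-dimensional Hausdorff measure on the window data `(ℝ^d × ℝ^d)^{labels}`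
   (`k` = number of window particles), ZERO if `ω ∉ Φ.good` or the window is empty;
   `windowPlaques Φ Λ`, `windowLocalPlaques Φ Λ δ : PlaqueFamily (PointConfig (ℝ^d × ℝ^d))`.
5. **The functor** `infiniteUnstablePlaques ε Φ : PlaqueFamily (PointConfig (ℝ^d × ℝ^d))`
   (the requested `L : (ε : ℝ) → InfiniteHardSphereFlow (Fin 3) ε → PlaqueFamily (PointConfig
   (V3 × V3))`, for any `d`): plaque = `⋃ₙ windowUnstableSet Φ (closedBall 0 (n+1)) ω`, leaf
   measure = `Measure.sum` of the window leaf measures ("countable union of sub-plaques"; weights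
   are irrelevant, only null sets enter `PlaqueFamily.IsURegular`).
6. **Proved API** (the acceptance-relevant structure):
   * junk values: `windowUnstableSet_eq_empty`, `windowLeafMeasure_of_notMem_good`,
     `windowLeafMeasure_of_windowLabels_eq_empty` (no Dirac leaf on an empty window),
     `isURegular_iff_eq_zero_of_good_null` (a law null on `Φ.good` is u-regular iff it is `0`);
   * LOCALITY (kills `plaque = univ`): `exterior_subset_of_mem_windowUnstableSet`,
     `finite_diff_of_mem_windowUnstableSet`;
   * MONOTONICITY: `IsURegular.of_windowLocalPlaques` (local ⇒ global),
     `IsURegular.of_windowPlaques` (one ball window ⇒ the functor);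
   * CONSISTENCY: `isWindowTrajectory_reversePath` (the reversed recorded paths of ANY solution of
     the infinite equations of motion form a window trajectory for every finite window — the
     left-continuous reversed-time clauses are exactly what the right-continuous forward clauses
     of `IsInfiniteHardSphereTrajectory` become), `implant_self`, hence
     `self_mem_windowUnstableSet` / `self_mem_infiniteUnstablePlaques_plaque` (`ω ∈ W(ω)` for good
     `ω`, `ε > 0`);
   * NO ATOMS (kills Dirac leaves): `measurable_implant` (implanting is measurable in the window
     data, so the push-forward is not Mathlib's junk `0`), `countable_coe_pointConfig`,
     `windowLeafMeasure_setOf_coe_subset_eq_zero` (configurations drawn from a countable set of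
     phase points are leaf-null, `d ≥ 1`), `windowLeafMeasure_singleton`,
     `infiniteUnstablePlaques_leafMeasure_singleton`.
7. **Acceptance tests as predicates** on a functor `L`: `PlaqueSanity L` (the planner's typed
   SANITY shape: dilute translation-invariant hard-sphere Gibbs states are `L 1 Φ`-u-regular under
   equilibrium flows — a conjecture for every `L`, NOT asserted; the route files
   `PlaqueSanity infiniteUnstablePlaques` as a support item) and `PlaqueTeeth L` (frozen
   stationary states are not u-regular; a THEOREM for this functor, proved in the companion file
   `InfiniteUnstablePlaquesTeeth`).

## Design choices

* *Why reversed time and a one-sided law.* Restricting the true infinite dynamics to a window,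
  a contact of a window particle `p` with an exterior particle `q` changes `p`'s velocity by the
  equal-mass law fed with `q`'s recorded incoming velocity; the exterior "held to its data" does
  not respond. In forward time this one-sided law is contracting and not injective (the normal
  component handed to `q` is forgotten), so backward continuation is not unique and a forward
  formulation of "backward convergence" would quantify over wild branches. In reversed time the
  same bookkeeping (with `q`'s forward-OUTGOING velocity, i.e. its reversed incoming one) is
  forward deterministic and the reversed recorded window paths solve it: unstable sets of the
  window are honest unstable sets of a (non-autonomous) deterministic system, exactly as for the
  frozen-exterior finite-volume maps of coupled map lattices (Jiang–Pesin 1998, Keller–Liverani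
  2009). An infinitely-massive-wall model of the exterior would NOT be solved by the recorded
  paths (`ω ∉ W(ω)`), and the naive slice "perturb the window, run the full dynamics backward" is
  generically trivial (finitely many unknowns, infinitely many constraints), see `URegularState`.
* *Leaf measure = Hausdorff measure of the full window unstable dimension `dk`, transported by
  `implant`.* The window system in a moving environment has no conserved quantity and no time
  autonomy, so the bookkeeping of `hardBallUnstableDim` leaves `dk` expanding directions; this is
  a modelling choice recorded in `windowUnstableDim` (a smaller exponent only weakens u-regularity,
  a larger one would make it vacuous). Ambient Lebesgue measure of the `2dk`-dimensional data space
  would make every law but `0` irregular (plaques are expected to be `dk`-dimensional), a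
  `0`-dimensional (Dirac) choice would make every law regular; both are excluded, and empty
  windows and non-good configurations contribute the zero measure.
* *Aggregation over ball windows* makes `IsURegular` for the functor the weakest of the window
  notions (`IsURegular.of_windowPlaques`), the right side for the INHERITANCE crux U1; U2 may
  quantify over windows through `windowPlaques`/`windowLocalPlaques` if it needs more.
* *No measurability of plaques is needed or claimed* (as in `URegularState`); `implant` IS proved
  measurable, which is what makes the leaf measures genuine push-forwards.
* NOT CLAIMED: existence/dimension of unstable manifolds of the window system, positivity of
  `windowLeafMeasure Φ Λ ω (windowUnstableSet Φ Λ ω)`, SANITY (no source; route support item),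
  teeth for laminar or periodised states (they need the dimension theory of the plaques, not only
  their definition); homogeneity strips are not needed to STATE absolute continuity (see
  `URegularState`), the countable-union form is nevertheless the one delivered.

## References (templates; the object itself is posited by the route)

* F. Ledrappier, L.-S. Young, *The metric entropy of diffeomorphisms I*, Ann. Math. 122 (1985),
  (1.2) p. 512, Def. 1.4.1–1.4.2 p. 513 [LedrappierYoung1985].
* Ya. B. Pesin, Ya. G. Sinai, ETDS 2 (1982) (u-Gibbs measures) [PesinSinai1982].
* M. Jiang, Ya. B. Pesin, *Equilibrium measures for coupled map lattices*, CMP 193 (1998);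
  G. Keller, C. Liverani, *Uniqueness of the SRB measure for piecewise expanding weakly coupled
  map lattices in any dimension*, CMP 262 (2006) / 2009 (finite windows with frozen exterior)
  [KellerLiverani2009].
* R. Alexander, *Time evolution for infinitely many hard spheres*, CMP 49 (1976) (the flow,
  non-regular solutions Cor. 5.4) [Alexander1976].
* Ya. G. Sinai, N. I. Chernov, Russ. Math. Surveys 42:3 (1987) (unstable manifolds of hard
  balls) [SinaiChernov1987].
-/

noncomputable section

open MeasureTheory Set Filter Metric Function Topology
open scoped ENNReal NNReal InnerProductSpace
open Literature.Analysis.FunctionSpaces Literature.Analysis.FluidPDE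

namespace Literature.Dynamics.Billiards

variable {d : Type*} [Fintype d]

local notation "𝔼" => EuclideanSpace ℝ d
local notation "𝕏" => EuclideanSpace ℝ d × EuclideanSpace ℝ d

/-! ## 1. Time reversal of phase points and paths -/

omit [Fintype d] in
/-- Time reversal of a phase point: `R (q, v) = (q, -v)`. [folklore] -/
def revPhase (p : 𝕏) : 𝕏 :=
  (p.1, -p.2)

omit [Fintype d] in
/-- Unfolding lemma. [folklore] -/
@[simp]
theorem revPhase_fst (p : 𝕏) : (revPhase p).1 = p.1 :=
  rfl

omit [Fintype d] in
/-- Unfolding lemma. [folklore] -/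
@[simp]
theorem revPhase_snd (p : 𝕏) : (revPhase p).2 = -p.2 :=
  rfl

omit [Fintype d] in
/-- Time reversal is an involution. [folklore] -/
@[simp]
theorem revPhase_revPhase (p : 𝕏) : revPhase (revPhase p) = p := by
  simp [revPhase]

omit [Fintype d] in
/-- The time-reversed path `s ↦ R (γ (-s))` of a phase-space path `γ`. [folklore] -/
def reversePath (γ : ℝ → 𝕏) (s : ℝ) : 𝕏 :=
  revPhase (γ (-s))

omit [Fintype d] in
/-- Unfolding lemma. [folklore] -/
@[simp]
theorem reversePath_fst (γ : ℝ → 𝕏) (s : ℝ) : (reversePath γ s).1 = (γ (-s)).1 :=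
  rfl

omit [Fintype d] in
/-- Unfolding lemma. [folklore] -/
@[simp]
theorem reversePath_snd (γ : ℝ → 𝕏) (s : ℝ) : (reversePath γ s).2 = -(γ (-s)).2 :=
  rfl

/-! ## 2. Window dynamics in a prescribed moving environment (reversed time) -/

/-- **Window trajectory in a prescribed environment** (the "window dynamics with the exterior
held to its data" posited by route UGibbsSRBRigidity, written in REVERSED time `s = -t ≥ 0`).
`z p : ℝ → ℝ^d × ℝ^d` is the path of the particle with label `p`; the labels in `W` (the window)
are dynamic, every other label in `S` is a prescribed mover whose path enters only through its
values. The clauses are those of `Literature.Analysis.FluidPDE.IsInfiniteHardSphereTrajectory`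
restricted to the window particles, for times `s ≥ 0`, with two differences forced by the
setting: (i) the collision law is ONE-SIDED — at a contact of a window particle `p` with any
particle `q` only `p`'s outgoing velocity is prescribed, by the first component of the elastic
law `reflectVel` fed with the current velocities of `p` and `q` (for two window particles the two
one-sided clauses together are the full elastic law); (ii) velocities are LEFT-continuous in
`s` (the value at a contact instant is the incoming velocity, the outgoing one is the right
limit), so that free flight is anchored at the right endpoint: if `p` has no contact in
`[σ, b)` then its state at `σ` is the free back-extrapolation of its state at `b`. With these
conventions the time reversals `s ↦ R (Φ.traj ω p (-s))` of the recorded paths of ANY solution of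
the infinite equations of motion form a window trajectory for every finite window
(`isWindowTrajectory_reversePath`), and the reversed-time window dynamics is forward
deterministic (whereas in forward time the one-sided law forgets the normal velocity handed to
the untracked partner). No published source defines this object; it is the route's posited
notion, cf. the frozen-exterior finite-volume dynamics of coupled map lattices
(Jiang–Pesin 1998; Keller–Liverani 2009). [folklore] -/
structure IsWindowTrajectory (ε : ℝ) (W S : Set 𝕏) (z : 𝕏 → ℝ → 𝕏) : Prop where
  /-- Hard core at all times `s ≥ 0` for pairs involving a window particle. -/
  hardCore : ∀ s : ℝ, 0 ≤ s → ∀ p ∈ W, ∀ q ∈ S, p ≠ q → ε ≤ ‖(z p s).1 - (z q s).1‖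
  /-- Window particles have finitely many contacts during bounded time intervals. -/
  locFinite : ∀ b : ℝ, (collisionEvents ε S z ∩ {e | e.1 ∈ W ∧ e.2 ∈ Icc 0 b}).Finite
  /-- Positions of window particles are continuous on `[0, ∞)`. -/
  pos_continuous : ∀ p ∈ W, ContinuousOn (fun s => (z p s).1) (Ici 0)
  /-- Free flight, anchored at the right endpoint: no contact of `p` in `[σ, b)` implies that
  the state at `σ` is the free back-extrapolation of the state at `b`. -/
  free : ∀ p ∈ W, ∀ σ b : ℝ, 0 ≤ σ → σ ≤ b →
    (∀ τ ∈ Ico σ b, (p, τ) ∉ collisionEvents ε S z) →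
      z p σ = ((z p b).1 + (σ - b) • (z p b).2, (z p b).2)
  /-- Contacts of a window particle are with a unique partner, non-grazing for the incoming
  (current) velocities, and the outgoing velocity (right limit) of the window particle is given
  by the elastic law. -/
  collision : ∀ p ∈ W, ∀ q ∈ S, p ≠ q → ∀ s : ℝ, 0 ≤ s → ‖(z p s).1 - (z q s).1‖ = ε →
    (∀ q' ∈ S, q' ≠ p → ‖(z p s).1 - (z q' s).1‖ = ε → q' = q) ∧
      ⟪(z p s).1 - (z q s).1, (z p s).2 - (z q s).2⟫_ℝ < 0 ∧
        Tendsto (fun σ => (z p σ).2) (𝓝[>] s)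
          (𝓝 (reflectVel ((z p s).1 - (z q s).1) ((z p s).2, (z q s).2)).1)

omit [Fintype d] in
open Classical in
/-- Glue window paths `x` (on the labels in `W`) with environment paths `e` (elsewhere).
[folklore] -/
def gluePaths (W : Set 𝕏) (x e : 𝕏 → ℝ → 𝕏) : 𝕏 → ℝ → 𝕏 :=
  fun p => if p ∈ W then x p else e p

omit [Fintype d] in
/-- On window labels the glued family is the window path. [folklore] -/
@[simp]
theorem gluePaths_of_mem {W : Set 𝕏} (x e : 𝕏 → ℝ → 𝕏) {p : 𝕏} (hp : p ∈ W) :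
    gluePaths W x e p = x p := by
  simp [gluePaths, hp]

omit [Fintype d] in
/-- Off the window the glued family is the environment path. [folklore] -/
@[simp]
theorem gluePaths_of_notMem {W : Set 𝕏} (x e : 𝕏 → ℝ → 𝕏) {p : 𝕏} (hp : p ∉ W) :
    gluePaths W x e p = e p := by
  simp [gluePaths, hp]

/-! ## 3. Windows, implanted configurations, unstable sets and leaf measures -/

open Classical in
/-- The **window labels** of a configuration `ω` for the window `Λ ⊆ ℝ^d`: the particles of `ω`
with position in `Λ`, as a `Finset` (the empty set if there are infinitely many, which does not
happen for a hard-sphere configuration and a bounded window,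
`PosLocallyFinite.finite_particlesIn`). [folklore] -/
def windowLabels (Λ : Set 𝔼) (ω : PointConfig 𝕏) : Finset 𝕏 :=
  if h : (particlesIn ω Λ).Finite then h.toFinset else ∅

omit [Fintype d] in
/-- For finitely many particles in the window, the window labels are exactly those particles.
[folklore] -/
theorem coe_windowLabels {Λ : Set 𝔼} {ω : PointConfig 𝕏} (h : (particlesIn ω Λ).Finite) :
    (windowLabels Λ ω : Set 𝕏) = particlesIn ω Λ := by
  simp [windowLabels, h]

omit [Fintype d] in
/-- Membership in the window labels (finite case). [folklore] -/
theorem mem_windowLabels_iff {Λ : Set 𝔼} {ω : PointConfig 𝕏} (h : (particlesIn ω Λ).Finite)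
    {p : 𝕏} : p ∈ windowLabels Λ ω ↔ p ∈ ω ∧ p.1 ∈ Λ := by
  rw [← Finset.mem_coe, coe_windowLabels h, mem_particlesIn_iff]

omit [Fintype d] in
/-- Window labels are particles of the configuration. [folklore] -/
theorem windowLabels_subset (Λ : Set 𝔼) (ω : PointConfig 𝕏) :
    (windowLabels Λ ω : Set 𝕏) ⊆ (ω : Set 𝕏) := by
  by_cases h : (particlesIn ω Λ).Finite
  · rw [coe_windowLabels h]
    exact fun p hp => hp.1
  · simp [windowLabels, h]

/-- The configuration obtained from `ω` by **replacing its particles in the window** `Λ × ℝ^d`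
by the finitely many phase points `y i`: `(ω ∩ (Λᶜ × ℝ^d)) ∪ {y i}` (the exterior is kept).
[folklore] -/
def implant (Λ : Set 𝔼) (ω : PointConfig 𝕏) {ι : Type*} [Finite ι] (y : ι → 𝕏) :
    PointConfig 𝕏 where
  carrier := ((ω : Set 𝕏) ∩ Prod.fst ⁻¹' Λᶜ) ∪ range y
  finite_inter_isCompact K hK := by
    rw [union_inter_distrib_right]
    exact ((ω.finite_inter_isCompact K hK).subset fun p hp => ⟨hp.1.1, hp.2⟩).union
      ((finite_range y).subset inter_subset_left)

omit [Fintype d] in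
/-- The points of an implanted configuration. [folklore] -/
@[simp]
theorem coe_implant (Λ : Set 𝔼) (ω : PointConfig 𝕏) {ι : Type*} [Finite ι] (y : ι → 𝕏) :
    (implant Λ ω y : Set 𝕏) = ((ω : Set 𝕏) ∩ Prod.fst ⁻¹' Λᶜ) ∪ range y :=
  rfl

omit [Fintype d] in
/-- Membership in an implanted configuration. [folklore] -/
theorem mem_implant_iff (Λ : Set 𝔼) (ω : PointConfig 𝕏) {ι : Type*} [Finite ι] (y : ι → 𝕏)
    {p : 𝕏} : p ∈ implant Λ ω y ↔ (p ∈ ω ∧ p.1 ∉ Λ) ∨ ∃ i, y i = p := by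
  change p ∈ (implant Λ ω y).carrier ↔ _
  simp [implant]

variable {ε : ℝ}

/-- The environment of the window dynamics attached to a configuration `ω`: the time reversals
`s ↦ R (Φ.traj ω q (-s))` of the recorded paths of the particles of `ω` under the flow `Φ` (the
exterior "held to its backward data"). [folklore] -/
def revTraj (Φ : InfiniteHardSphereFlow d ε) (ω : PointConfig 𝕏) (q : 𝕏) : ℝ → 𝕏 :=
  reversePath (Φ.traj ω q)

/-- Unfolding lemma. [folklore] -/
@[simp]
theorem revTraj_apply (Φ : InfiniteHardSphereFlow d ε) (ω : PointConfig 𝕏) (q : 𝕏) (s : ℝ) :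
    revTraj Φ ω q s = revPhase (Φ.traj ω q (-s)) :=
  rfl

/-- The **unstable set of `ω` for the window `Λ`** under the infinite hard-sphere flow `Φ`
(route-posited object; the analogue of Ledrappier–Young's (1.2)
`W^u(x) = {y | d(f⁻ⁿ y, f⁻ⁿ x) → 0 exponentially}` for the window system in the recorded
environment): the configurations `ω'` obtained from a GOOD configuration `ω` by replacing the
phase points of its finitely many particles in `Λ × ℝ^d` by the time-`0` data of a window
trajectory (reversed time, exterior particles on their reversed recorded paths) which converges
exponentially fast, in phase space and particle by particle, to the reversed recorded paths of
the window particles. Empty if `ω ∉ Φ.good`. [cite: LedrappierYoung1985, (1.2) p. 512] -/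
def windowUnstableSet (Φ : InfiniteHardSphereFlow d ε) (Λ : Set 𝔼) (ω : PointConfig 𝕏) :
    Set (PointConfig 𝕏) :=
  {ω' | ω ∈ Φ.good ∧ ∃ x : 𝕏 → ℝ → 𝕏,
    IsWindowTrajectory ε (windowLabels Λ ω : Set 𝕏) (ω : Set 𝕏)
        (gluePaths (windowLabels Λ ω : Set 𝕏) x (revTraj Φ ω)) ∧
      (∃ r : ℝ, 0 < r ∧ ∀ᶠ s : ℝ in atTop, ∀ p ∈ windowLabels Λ ω,
        dist (x p s) (revTraj Φ ω p s) ≤ Real.exp (-(r * s))) ∧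
      ω' = implant Λ ω (fun p : ↥(windowLabels Λ ω) => revPhase (x p 0))}

/-- The **local unstable set of size `δ`** of `ω` for the window `Λ`: as `windowUnstableSet`,
the window trajectory staying moreover `δ`-close to the recorded one at all times `s ≥ 0`
(Ledrappier–Young's local leaves `W^u_δ`). [cite: LedrappierYoung1985, (1.2) p. 512] -/
def windowLocalUnstableSet (Φ : InfiniteHardSphereFlow d ε) (Λ : Set 𝔼) (δ : ℝ)
    (ω : PointConfig 𝕏) : Set (PointConfig 𝕏) :=
  {ω' | ω ∈ Φ.good ∧ ∃ x : 𝕏 → ℝ → 𝕏,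
    IsWindowTrajectory ε (windowLabels Λ ω : Set 𝕏) (ω : Set 𝕏)
        (gluePaths (windowLabels Λ ω : Set 𝕏) x (revTraj Φ ω)) ∧
      (∃ r : ℝ, 0 < r ∧ ∀ᶠ s : ℝ in atTop, ∀ p ∈ windowLabels Λ ω,
        dist (x p s) (revTraj Φ ω p s) ≤ Real.exp (-(r * s))) ∧
      (∀ s : ℝ, 0 ≤ s → ∀ p ∈ windowLabels Λ ω, dist (x p s) (revTraj Φ ω p s) ≤ δ) ∧
      ω' = implant Λ ω (fun p : ↥(windowLabels Λ ω) => revPhase (x p 0))}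

variable (d) in
/-- The **unstable dimension of a window of `k` particles in a moving environment**: `d k`.
Bookkeeping: the window phase space `(ℝ^d × ℝ^d)^k` has dimension `2dk`; the environment is time
dependent and exchanges momentum and energy with the window, so none of the neutral directions
of the closed `N`-particle system (`hardBallUnstableDim`: momentum, energy, centre of mass, flow
direction) survives, and complete hyperbolicity splits `2dk = dk + dk`. This is the route's
"full local unstable dimension of the window system"; it is a modelling choice, not a theorem
(a smaller exponent only weakens u-regularity — `μH[s]`-null sets are `μH[t]`-null for `t > s` —
a larger one would make it vacuous). [folklore] -/
def windowUnstableDim (k : ℕ) : ℝ :=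
  ((Fintype.card d * k : ℕ) : ℝ)

/-- Unfolding lemma. [folklore] -/
theorem windowUnstableDim_eq (k : ℕ) :
    windowUnstableDim d k = ((Fintype.card d * k : ℕ) : ℝ) :=
  rfl

/-- The window unstable dimension is positive as soon as `d ≥ 1` and the window holds a
particle. [folklore] -/
theorem windowUnstableDim_pos [Nonempty d] {k : ℕ} (hk : 0 < k) : 0 < windowUnstableDim d k := by
  rw [windowUnstableDim_eq]
  exact_mod_cast Nat.mul_pos Fintype.card_pos hk

open Classical in
/-- The **leaf measure on the window-`Λ` plaque through `ω`**: the `dk`-dimensional Hausdorff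
measure (`k` = number of particles of `ω` in the window, `windowUnstableDim`) on the parameter
space `(ℝ^d × ℝ^d)^{window labels}` of time-`0` window data, transported to configurations by
`implant` — the Lebesgue class of the full local unstable dimension of the window system. It is
the ZERO measure when `ω` is not a good configuration of `Φ` or has no particle in the window
(no Dirac leaves: an empty window carries no unstable direction). [cite: LedrappierYoung1985, (1.2) p. 512] -/
def windowLeafMeasure (Φ : InfiniteHardSphereFlow d ε) (Λ : Set 𝔼) (ω : PointConfig 𝕏) :
    Measure (PointConfig 𝕏) :=
  if ω ∈ Φ.good ∧ (windowLabels Λ ω).Nonempty then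
    (μH[windowUnstableDim d (windowLabels Λ ω).card] :
        Measure (↥(windowLabels Λ ω) → 𝕏)).map (fun y => implant Λ ω y)
  else 0

/-- The **window-`Λ` unstable plaque family** of the infinite hard-sphere flow `Φ`: plaque
through `ω` = `windowUnstableSet Φ Λ ω`, leaf measure = `windowLeafMeasure Φ Λ ω`.
[cite: LedrappierYoung1985, (1.2) p. 512] -/
def windowPlaques (Φ : InfiniteHardSphereFlow d ε) (Λ : Set 𝔼) : PlaqueFamily (PointConfig 𝕏) where
  plaque := windowUnstableSet Φ Λ
  leafMeasure := windowLeafMeasure Φ Λ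

/-- The **local** window-`Λ` unstable plaque family of size `δ`. [cite: LedrappierYoung1985, (1.2) p. 512] -/
def windowLocalPlaques (Φ : InfiniteHardSphereFlow d ε) (Λ : Set 𝔼) (δ : ℝ) :
    PlaqueFamily (PointConfig 𝕏) where
  plaque := windowLocalUnstableSet Φ Λ δ
  leafMeasure := windowLeafMeasure Φ Λ

/-- **The unstable-plaque functor of the infinite hard-sphere flow** (definition request
`defn-InfiniteUnstablePlaques` of route UGibbsSRBRigidity): to a flow `Φ` of spheres of diameter
`ε` it attaches the plaque family on `PointConfig (ℝ^d × ℝ^d)` whose plaque through `ω` is the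
union over the ball windows `Λ_n = closedBall 0 (n+1)` of the window unstable sets
`windowUnstableSet Φ Λ_n ω`, and whose leaf measure is the sum of the window leaf measures (a
countable union of finite-dimensional sub-plaques, each with the Hausdorff measure of its own full
unstable dimension; weights are irrelevant since only null sets enter `PlaqueFamily.IsURegular`).
A law is u-regular for it as soon as it is u-regular for one ball window
(`IsURegular.of_windowPlaques`). [cite: LedrappierYoung1985, (1.2) p. 512] -/
def infiniteUnstablePlaques (ε : ℝ) (Φ : InfiniteHardSphereFlow d ε) :
    PlaqueFamily (PointConfig 𝕏) where
  plaque ω := ⋃ n : ℕ, windowUnstableSet Φ (closedBall (0 : 𝔼) (n + 1)) ω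
  leafMeasure ω := Measure.sum fun n : ℕ => windowLeafMeasure Φ (closedBall (0 : 𝔼) (n + 1)) ω

/-! ## 4. Basic properties: junk values, locality, monotonicity -/

section Basic

variable {Φ : InfiniteHardSphereFlow d ε} {Λ : Set (EuclideanSpace ℝ d)} {δ : ℝ}
  {ω ω' : PointConfig (EuclideanSpace ℝ d × EuclideanSpace ℝ d)} -- (no local notation in `variable`)

/-- Off the good set the window unstable set is empty. [folklore] -/
theorem windowUnstableSet_eq_empty (h : ω ∉ Φ.good) : windowUnstableSet Φ Λ ω = ∅ :=
  eq_empty_of_forall_notMem fun _ h' => h h'.1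

/-- Members of a window unstable set come from good configurations. [folklore] -/
theorem mem_good_of_mem_windowUnstableSet (h : ω' ∈ windowUnstableSet Φ Λ ω) : ω ∈ Φ.good :=
  h.1

/-- Off the good set the window leaf measure vanishes. [folklore] -/
theorem windowLeafMeasure_of_notMem_good (h : ω ∉ Φ.good) : windowLeafMeasure Φ Λ ω = 0 := by
  classical
  simp [windowLeafMeasure, h]

/-- An empty window carries the zero leaf measure (no Dirac leaves). [folklore] -/
theorem windowLeafMeasure_of_windowLabels_eq_empty (h : windowLabels Λ ω = ∅) :
    windowLeafMeasure Φ Λ ω = 0 := by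
  classical
  simp [windowLeafMeasure, h]

/-- The window leaf measure of a good configuration with a particle in the window is the
transported Hausdorff measure of the window unstable dimension. [folklore] -/
theorem windowLeafMeasure_eq_map (hω : ω ∈ Φ.good) (hne : (windowLabels Λ ω).Nonempty) :
    windowLeafMeasure Φ Λ ω =
      (μH[windowUnstableDim d (windowLabels Λ ω).card] :
        Measure (↥(windowLabels Λ ω) → 𝕏)).map (fun y => implant Λ ω y) := by
  classical
  simp [windowLeafMeasure, hω, hne]

/-- Local window unstable sets are contained in the window unstable set. [folklore] -/
theorem windowLocalUnstableSet_subset :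
    windowLocalUnstableSet Φ Λ δ ω ⊆ windowUnstableSet Φ Λ ω := by
  rintro ω' ⟨hω, x, hx, hconv, -, hω'⟩
  exact ⟨hω, x, hx, hconv, hω'⟩

/-- **Locality**: a configuration in the window-`Λ` unstable set of `ω` contains every particle
of `ω` outside the window … [folklore] -/
theorem exterior_subset_of_mem_windowUnstableSet (h : ω' ∈ windowUnstableSet Φ Λ ω) :
    (ω : Set 𝕏) ∩ Prod.fst ⁻¹' Λᶜ ⊆ (ω' : Set 𝕏) := by
  obtain ⟨-, x, -, -, rfl⟩ := h
  rw [coe_implant]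
  exact subset_union_left

/-- … and only finitely many particles that are not particles of `ω` (the perturbed window
particles). [folklore] -/
theorem finite_diff_of_mem_windowUnstableSet (h : ω' ∈ windowUnstableSet Φ Λ ω) :
    ((ω' : Set 𝕏) \ (ω : Set 𝕏)).Finite := by
  obtain ⟨-, x, -, -, rfl⟩ := h
  rw [coe_implant]
  refine (finite_range fun p : ↥(windowLabels Λ ω) => revPhase (x p 0)).subset ?_
  rintro p ⟨hp | hp, hp'⟩
  · exact absurd hp.1 hp'
  · exact hp

/-- Unfolding lemma: the plaques of the functor. [folklore] -/
@[simp]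
theorem infiniteUnstablePlaques_plaque (Φ : InfiniteHardSphereFlow d ε) (ω : PointConfig 𝕏) :
    (infiniteUnstablePlaques ε Φ).plaque ω =
      ⋃ n : ℕ, windowUnstableSet Φ (closedBall (0 : 𝔼) (n + 1)) ω :=
  rfl

/-- Unfolding lemma: the leaf measures of the functor. [folklore] -/
@[simp]
theorem infiniteUnstablePlaques_leafMeasure (Φ : InfiniteHardSphereFlow d ε) (ω : PointConfig 𝕏) :
    (infiniteUnstablePlaques ε Φ).leafMeasure ω =
      Measure.sum fun n : ℕ => windowLeafMeasure Φ (closedBall (0 : 𝔼) (n + 1)) ω :=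
  rfl

/-- Unfolding lemma. [folklore] -/
@[simp]
theorem windowPlaques_plaque (Φ : InfiniteHardSphereFlow d ε) (Λ : Set 𝔼) (ω : PointConfig 𝕏) :
    (windowPlaques Φ Λ).plaque ω = windowUnstableSet Φ Λ ω :=
  rfl

/-- Unfolding lemma. [folklore] -/
@[simp]
theorem windowPlaques_leafMeasure (Φ : InfiniteHardSphereFlow d ε) (Λ : Set 𝔼)
    (ω : PointConfig 𝕏) : (windowPlaques Φ Λ).leafMeasure ω = windowLeafMeasure Φ Λ ω :=
  rfl

/-- Unfolding lemma. [folklore] -/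
@[simp]
theorem windowLocalPlaques_plaque (Φ : InfiniteHardSphereFlow d ε) (Λ : Set 𝔼) (δ : ℝ)
    (ω : PointConfig 𝕏) : (windowLocalPlaques Φ Λ δ).plaque ω = windowLocalUnstableSet Φ Λ δ ω :=
  rfl

/-- Unfolding lemma. [folklore] -/
@[simp]
theorem windowLocalPlaques_leafMeasure (Φ : InfiniteHardSphereFlow d ε) (Λ : Set 𝔼) (δ : ℝ)
    (ω : PointConfig 𝕏) : (windowLocalPlaques Φ Λ δ).leafMeasure ω = windowLeafMeasure Φ Λ ω :=
  rfl

/-- Off the good set the plaque of the functor is empty. [folklore] -/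
theorem infiniteUnstablePlaques_plaque_eq_empty (Φ : InfiniteHardSphereFlow d ε) (h : ω ∉ Φ.good) :
    (infiniteUnstablePlaques ε Φ).plaque ω = ∅ := by
  simp [windowUnstableSet_eq_empty h]

/-- Off the good set the leaf measure of the functor vanishes. [folklore] -/
theorem infiniteUnstablePlaques_leafMeasure_eq_zero (Φ : InfiniteHardSphereFlow d ε)
    (h : ω ∉ Φ.good) : (infiniteUnstablePlaques ε Φ).leafMeasure ω = 0 := by
  simp [windowLeafMeasure_of_notMem_good h]

/-- **Smaller plaques, stronger u-regularity**: a law u-regular for the LOCAL window plaques of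
some size is u-regular for the window plaques. [folklore] -/
theorem _root_.Literature.Dynamics.Billiards.PlaqueFamily.IsURegular.of_windowLocalPlaques
    {μ : Measure (PointConfig 𝕏)} (h : (windowLocalPlaques Φ Λ δ).IsURegular μ) :
    (windowPlaques Φ Λ).IsURegular μ := by
  intro s hs hnull
  refine h s hs ?_
  filter_upwards [hnull] with ω hω
  exact measure_mono_null (inter_subset_inter_right _ windowLocalUnstableSet_subset) hω

/-- **One window suffices**: a law u-regular for the plaques of one ball window
`closedBall 0 (n+1)` is u-regular for the plaque functor (whose leaf-null sets are null for
every window leaf measure). [folklore] -/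
theorem _root_.Literature.Dynamics.Billiards.PlaqueFamily.IsURegular.of_windowPlaques
    {μ : Measure (PointConfig 𝕏)} (n : ℕ)
    (h : (windowPlaques Φ (closedBall (0 : 𝔼) (n + 1))).IsURegular μ) :
    (infiniteUnstablePlaques ε Φ).IsURegular μ := by
  intro s hs hnull
  refine h s hs ?_
  filter_upwards [hnull] with ω hω
  rw [infiniteUnstablePlaques_leafMeasure, Measure.sum_apply_eq_zero] at hω
  exact measure_mono_null
    (inter_subset_inter_right _ (subset_iUnion (fun m : ℕ =>
      windowUnstableSet Φ (closedBall (0 : 𝔼) (m + 1)) ω) n)) (hω n)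

/-- **Teeth, zeroth form**: a law giving no mass to the good set of the flow is u-regular for
the functor only if it is zero (plaques are empty off the good set). [folklore] -/
theorem isURegular_iff_eq_zero_of_good_null (Φ : InfiniteHardSphereFlow d ε)
    {μ : Measure (PointConfig 𝕏)} (hμ : μ Φ.good = 0) :
    (infiniteUnstablePlaques ε Φ).IsURegular μ ↔ μ = 0 := by
  refine ⟨fun h => ?_, fun h => h ▸ PlaqueFamily.isURegular_zero _⟩
  rw [← Measure.measure_univ_eq_zero]
  refine h univ MeasurableSet.univ ?_
  have hae : ∀ᵐ ω ∂μ, ω ∉ Φ.good := by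
    rw [ae_iff]
    simpa only [not_not, setOf_mem_eq] using hμ
  filter_upwards [hae] with ω hω
  rw [infiniteUnstablePlaques_plaque_eq_empty Φ hω, inter_empty, measure_empty]

end Basic

/-! ## 5. Consistency: reversed recorded paths are window trajectories; `ω ∈ W(ω)` -/

section Consistency

/-- Linearity of the reflection law in the velocities: reversing both velocities reverses the
outgoing ones. [folklore] -/
theorem reflectVel_neg_neg (n vp vq : 𝔼) :
    reflectVel n (-vp, -vq) = (-(reflectVel n (vp, vq)).1, -(reflectVel n (vp, vq)).2) := by
  simp only [reflectVel, neg_sub_neg, inner_sub_left, sub_div, sub_smul, Prod.mk.injEq]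
  constructor <;> abel

/-- Collision events of the time-reversed family are the time-reversed collision events.
[folklore] -/
theorem mem_collisionEvents_reversePath_iff {ε : ℝ} {S : Set 𝕏} {x : 𝕏 → ℝ → 𝕏}
    {e : 𝕏 × ℝ} :
    e ∈ collisionEvents ε S (fun p => reversePath (x p)) ↔ (e.1, -e.2) ∈ collisionEvents ε S x := by
  simp only [mem_collisionEvents, reversePath_fst]

/-- **Consistency of the window dynamics with the infinite dynamics**: for every solution `x` of
the infinite hard-sphere equations of motion with label set `S` and every finite window `W ⊆ S`,
the time-reversed paths `s ↦ R (x p (-s))` form a window trajectory (all particles, window and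
exterior, on their reversed recorded paths). The left-continuous reversed-time conventions of
`IsWindowTrajectory` are exactly what the right-continuous forward clauses of
`IsInfiniteHardSphereTrajectory` turn into. [folklore] -/
theorem isWindowTrajectory_reversePath {ε : ℝ} {W S : Set 𝕏} (hWS : W ⊆ S) (hW : W.Finite)
    {x : 𝕏 → ℝ → 𝕏} (hx : IsInfiniteHardSphereTrajectory ε S x) :
    IsWindowTrajectory ε W S (fun p => reversePath (x p)) where
  hardCore s _ p hp q hq hpq := by
    simpa only [reversePath_fst] using hx.hardCore (-s) p (hWS hp) q hq hpq
  locFinite b := by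
    -- positions of the window particles during `[-b, 0]` stay in a bounded set
    have hK : IsCompact (⋃ p ∈ W, (fun t => (x p t).1) '' Icc (-b) 0) :=
      hW.isCompact_biUnion fun p hp => (isCompact_Icc.image (hx.pos_continuous p (hWS hp)))
    obtain ⟨r, hr⟩ := hK.isBounded.subset_closedBall 0
    have hfin := (hx.locFinite r (-b) 0).preimage
      (f := fun e : 𝕏 × ℝ => (e.1, -e.2)) (fun e _ e' _ h => by
        simpa [Prod.ext_iff, neg_inj] using h)
    refine hfin.subset ?_
    rintro e ⟨he, heW, he0, heb⟩
    refine ⟨mem_collisionEvents_reversePath_iff.1 he, ?_, by linarith, by linarith⟩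
    have hmem : (x e.1 (-e.2)).1 ∈ ⋃ p ∈ W, (fun t => (x p t).1) '' Icc (-b) 0 :=
      mem_biUnion heW ⟨-e.2, ⟨by linarith, by linarith⟩, rfl⟩
    simpa only [mem_closedBall, dist_zero_right] using hr hmem
  pos_continuous p hp :=
    ((hx.pos_continuous p (hWS hp)).comp continuous_neg).continuousOn
  free p hp σ b _ hσb hfree := by
    have key := hx.free p (hWS hp) (-b) (-σ) (by linarith) fun τ hτ hcoll => by
      refine hfree (-τ) ⟨by linarith [hτ.2], by linarith [hτ.1]⟩ ?_
      rw [mem_collisionEvents_reversePath_iff]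
      simpa only [neg_neg] using hcoll
    simp only [reversePath, revPhase, key, Prod.mk.injEq, smul_neg, and_true]
    rw [show -σ - -b = -(σ - b) by ring, neg_smul]
  collision p hp q hq hpq s _ hcontact := by
    have hpS := hWS hp
    simp only [reversePath_fst, reversePath_snd] at hcontact ⊢
    set t₀ : ℝ := -s with ht₀
    obtain ⟨huniq, vp, vq, hvp, hvq, hgraze, houtp⟩ := hx.binary p hpS q hq hpq t₀ hcontact
    have hcontact' : ‖(x q t₀).1 - (x p t₀).1‖ = ε := by rw [norm_sub_rev]; exact hcontact
    obtain ⟨-, vq', vp', hvq', hvp', -, houtq⟩ := hx.binary q hq p hpS hpq.symm t₀ hcontact'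
    have hvq_eq : vq' = vq := tendsto_nhds_unique hvq' hvq
    have hvp_eq : vp' = vp := tendsto_nhds_unique hvp' hvp
    rw [hvq_eq, hvp_eq] at houtq
    set n : 𝔼 := (x p t₀).1 - (x q t₀).1 with hn
    -- the outgoing pair of the forward collision is the reflected incoming pair
    have h1 : (x p t₀).2 = (reflectVel n (vp, vq)).1 := houtp
    have h2 : (x q t₀).2 = (reflectVel n (vp, vq)).2 := by
      rw [houtq, show (x q t₀).1 - (x p t₀).1 = -n by rw [hn, neg_sub], reflectVel_neg]
      exact congrArg Prod.fst (reflectVel_swap n (vp, vq))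
    refine ⟨huniq, ?_, ?_⟩
    · -- non-grazing of the reversed incoming velocities
      have hn0 : n ≠ 0 := by
        intro h0
        rw [h0, inner_zero_left] at hgraze
        exact lt_irrefl _ hgraze
      have hnn : ‖n‖ ^ 2 ≠ 0 := pow_ne_zero _ (norm_ne_zero_iff.2 hn0)
      have hcalc : ⟪n, -(x p t₀).2 - -(x q t₀).2⟫_ℝ = ⟪n, vp - vq⟫_ℝ := by
        rw [h1, h2]
        simp only [reflectVel, inner_sub_right, inner_add_right, inner_neg_right, inner_smul_right,
          real_inner_self_eq_norm_sq, real_inner_comm n]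
        field_simp
        ring
      rw [hcalc]
      exact hgraze
    · -- outgoing velocity of `p` in reversed time = minus its forward incoming velocity
      have hlim : Tendsto (fun σ : ℝ => -(x p (-σ)).2) (𝓝[>] s) (𝓝 (-vp)) := by
        have h3 : Tendsto (fun σ : ℝ => -σ) (𝓝[>] s) (𝓝[<] t₀) := by
          rw [ht₀]; exact tendsto_neg_nhdsGT
        exact (hvp.comp h3).neg
      convert hlim using 2
      rw [show ((-(x p t₀).2, -(x q t₀).2) : 𝔼 × 𝔼) = reflectVel n (-vp, -vq) by
        rw [reflectVel_neg_neg, h1, h2], reflectVel_reflectVel]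

variable {Φ : InfiniteHardSphereFlow d ε} {Λ : Set (EuclideanSpace ℝ d)}
  {ω : PointConfig (EuclideanSpace ℝ d × EuclideanSpace ℝ d)}

omit [Fintype d] in
/-- Gluing a family with itself changes nothing. [folklore] -/
@[simp]
theorem gluePaths_self (W : Set 𝕏) (e : 𝕏 → ℝ → 𝕏) : gluePaths W e e = e := by
  funext p
  by_cases hp : p ∈ W <;> simp [hp]

/-- For a hard-sphere configuration (e.g. a good one) and a bounded window, the window labels
are the particles in the window. [folklore] -/
theorem coe_windowLabels_of_isHardCore (hε : 0 < ε) (hω : IsHardCore ε ω)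
    (hΛ : Bornology.IsBounded Λ) : (windowLabels Λ ω : Set 𝕏) = particlesIn ω Λ :=
  coe_windowLabels ((hω.posLocallyFinite hε).finite_particlesIn hΛ)

omit [Fintype d] in
/-- **Implanting the recorded window data gives back the configuration.** [folklore] -/
theorem implant_self (h : (particlesIn ω Λ).Finite) :
    implant Λ ω (fun p : ↥(windowLabels Λ ω) => (p : 𝕏)) = ω := by
  ext p
  rw [mem_implant_iff]
  constructor
  · rintro (hp | ⟨i, rfl⟩)
    · exact hp.1
    · exact windowLabels_subset Λ ω i.2
  · intro hp
    by_cases hpΛ : p.1 ∈ Λ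
    · exact Or.inr ⟨⟨p, (mem_windowLabels_iff h).2 ⟨hp, hpΛ⟩⟩, rfl⟩
    · exact Or.inl ⟨hp, hpΛ⟩

/-- **Every good configuration lies on its own window plaque** (for `ε > 0` and a bounded
window): the reversed recorded paths are a window trajectory converging to themselves.
[folklore] -/
theorem self_mem_windowUnstableSet (hε : 0 < ε) (hΛ : Bornology.IsBounded Λ) (hω : ω ∈ Φ.good) :
    ω ∈ windowUnstableSet Φ Λ ω := by
  have hfin : (particlesIn ω Λ).Finite :=
    ((Φ.good_subset hω).posLocallyFinite hε).finite_particlesIn hΛ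
  refine ⟨hω, revTraj Φ ω, ?_, ⟨1, one_pos, Eventually.of_forall fun s p _ => ?_⟩, ?_⟩
  · rw [gluePaths_self]
    exact isWindowTrajectory_reversePath (windowLabels_subset Λ ω)
      (windowLabels Λ ω).finite_toSet (Φ.isTrajectory ω hω)
  · rw [dist_self]
    exact (Real.exp_pos _).le
  · conv_lhs => rw [← implant_self hfin]
    congr 1
    funext p
    rw [revTraj_apply, neg_zero, Φ.traj_zero ω hω p (windowLabels_subset Λ ω p.2),
      revPhase_revPhase]

/-- Every good configuration lies on its own LOCAL window plaque of nonnegative size.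
[folklore] -/
theorem self_mem_windowLocalUnstableSet (hε : 0 < ε) (hΛ : Bornology.IsBounded Λ) {δ : ℝ}
    (hδ : 0 ≤ δ) (hω : ω ∈ Φ.good) : ω ∈ windowLocalUnstableSet Φ Λ δ ω := by
  obtain ⟨-, x, hx, hconv, hω'⟩ := self_mem_windowUnstableSet (Λ := Λ) hε hΛ hω
  -- rebuild with the canonical witness to get the closeness clause
  have hfin : (particlesIn ω Λ).Finite :=
    ((Φ.good_subset hω).posLocallyFinite hε).finite_particlesIn hΛ
  refine ⟨hω, revTraj Φ ω, ?_, ⟨1, one_pos, Eventually.of_forall fun s p _ => ?_⟩,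
    fun s _ p _ => ?_, ?_⟩
  · rw [gluePaths_self]
    exact isWindowTrajectory_reversePath (windowLabels_subset Λ ω)
      (windowLabels Λ ω).finite_toSet (Φ.isTrajectory ω hω)
  · rw [dist_self]
    exact (Real.exp_pos _).le
  · rw [dist_self]
    exact hδ
  · conv_lhs => rw [← implant_self hfin]
    congr 1
    funext p
    rw [revTraj_apply, neg_zero, Φ.traj_zero ω hω p (windowLabels_subset Λ ω p.2),
      revPhase_revPhase]

/-- Every good configuration lies on its own plaque of the functor (`ε > 0`). [folklore] -/
theorem self_mem_infiniteUnstablePlaques_plaque (hε : 0 < ε) (hω : ω ∈ Φ.good) :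
    ω ∈ (infiniteUnstablePlaques ε Φ).plaque ω :=
  mem_iUnion.2 ⟨0, self_mem_windowUnstableSet hε isBounded_closedBall hω⟩

end Consistency

/-! ## 6. Measurability of implanting; leaf measures have no atoms -/

section Measurability

/-- A locally finite configuration of the (σ-compact) phase space is countable. [folklore] -/
theorem countable_coe_pointConfig (ω : PointConfig 𝕏) : (ω : Set 𝕏).Countable := by
  have hcov : (ω : Set 𝕏) ⊆ ⋃ n : ℕ, ((ω : Set 𝕏) ∩ closedBall (0 : 𝕏) n) := by
    intro p hp
    refine mem_iUnion.2 ⟨⌈‖p‖⌉₊, hp, ?_⟩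
    rw [mem_closedBall, dist_zero_right]
    exact Nat.le_ceil _
  refine (countable_iUnion fun n => ?_).mono hcov
  exact (ω.finite_inter_isCompact _ (isCompact_closedBall (0 : 𝕏) n)).countable

/-- The number of distinct values, lying in a measurable set `T`, taken by finitely many
coordinates of `y` is a measurable function of `y`. [folklore] -/
theorem measurable_encard_image_inter {ι : Type*} (J : Finset ι) {T : Set 𝕏}
    (hT : MeasurableSet T) :
    Measurable fun y : ι → 𝕏 => ((y '' (J : Set ι)) ∩ T).encard := by
  classical
  induction J using Finset.induction_on with
  | empty =>
    simp only [Finset.coe_empty, image_empty, empty_inter, encard_empty]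
    exact measurable_const
  | insert i J hiJ ih =>
    have hset : MeasurableSet {y : ι → 𝕏 | y i ∈ T ∧ y i ∉ y '' (J : Set ι)} := by
      have hrw : {y : ι → 𝕏 | y i ∈ T ∧ y i ∉ y '' (J : Set ι)} =
          (fun y : ι → 𝕏 => y i) ⁻¹' T ∩ ⋂ j ∈ J, {y : ι → 𝕏 | y j = y i}ᶜ := by
        ext y
        simp only [mem_setOf_eq, mem_image, Finset.mem_coe, not_exists, not_and, mem_inter_iff,
          mem_preimage, mem_iInter, mem_compl_iff]
      rw [hrw]
      exact (measurable_pi_apply i hT).inter (Finset.measurableSet_biInter J fun j _ =>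
        (measurableSet_eq_fun (measurable_pi_apply j) (measurable_pi_apply i)).compl)
    have heq : (fun y : ι → 𝕏 => ((y '' ((insert i J : Finset ι) : Set ι)) ∩ T).encard) =
        fun y => ((y '' (J : Set ι)) ∩ T).encard +
          (if y i ∈ T ∧ y i ∉ y '' (J : Set ι) then 1 else 0) := by
      funext y
      rw [Finset.coe_insert, image_insert_eq]
      by_cases hi : y i ∈ T
      · rw [insert_inter_of_mem hi]
        by_cases hiU : y i ∈ y '' (J : Set ι)
        · rw [insert_eq_of_mem (mem_inter hiU hi), if_neg (fun h => h.2 hiU), add_zero]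
        · rw [encard_insert_of_notMem (fun h => hiU h.1), if_pos ⟨hi, hiU⟩]
      · rw [insert_inter_of_notMem hi, if_neg (fun h => hi h.1), add_zero]
    rw [heq]
    exact (Measurable.of_discrete (f := fun c : ℕ∞ × ℕ∞ => c.1 + c.2)).comp
      (ih.prodMk (Measurable.ite hset measurable_const measurable_const))

/-- **Implanting is measurable** in the window data (any window): the count of the implanted
configuration in a measurable set is a constant plus the number of distinct implanted points
falling in it off the (countable, hence measurable) exterior. [folklore] -/
theorem measurable_implant (Λ : Set 𝔼) (ω : PointConfig 𝕏) {ι : Type*}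
    [Fintype ι] : Measurable fun y : ι → 𝕏 => implant Λ ω y := by
  classical
  refine PointConfig.measurable_of_count fun s hs => ?_
  set A : Set 𝕏 := (ω : Set 𝕏) ∩ Prod.fst ⁻¹' Λᶜ with hA
  have hAc : A.Countable := (countable_coe_pointConfig ω).mono inter_subset_left
  have hT : MeasurableSet (s \ A) := hs.diff hAc.measurableSet
  have hcount : ∀ y : ι → 𝕏, (implant Λ ω y).count s =
      (A ∩ s).encard + ((y '' ((Finset.univ : Finset ι) : Set ι)) ∩ (s \ A)).encard := by
    intro y
    rw [Finset.coe_univ, image_univ, PointConfig.count,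
      ← encard_union_eq (disjoint_left.2 fun p hp hp' => hp'.2.2 hp.1)]
    congr 1
    ext p
    simp only [hA, implant, mem_inter_iff, mem_union, Set.mem_sdiff, mem_preimage, mem_compl_iff]
    tauto
  simp_rw [hcount]
  exact (Measurable.of_discrete (f := fun c : ℕ∞ => (A ∩ s).encard + c)).comp
    (measurable_encard_image_inter Finset.univ hT)

omit [Fintype d] in
/-- The configurations all of whose particles lie in a measurable set form a measurable set of
configurations (a count event). [folklore] -/
theorem measurableSet_setOf_coe_subset {C : Set 𝕏} (hC : MeasurableSet C) :
    MeasurableSet {ω' : PointConfig 𝕏 | (ω' : Set 𝕏) ⊆ C} := by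
  have hrw : {ω' : PointConfig 𝕏 | (ω' : Set 𝕏) ⊆ C} =
      (fun ω' : PointConfig 𝕏 => ω'.count Cᶜ) ⁻¹' {0} := by
    ext ω'
    simp only [mem_setOf_eq, mem_preimage, mem_singleton_iff, PointConfig.count, encard_eq_zero,
      ← sdiff_eq, sdiff_eq_empty, PointConfig.coe_eq_carrier]
  rw [hrw]
  exact PointConfig.measurable_count hC.compl (measurableSet_singleton 0)

variable {Φ : InfiniteHardSphereFlow d ε} {Λ : Set (EuclideanSpace ℝ d)}
  {ω : PointConfig (EuclideanSpace ℝ d × EuclideanSpace ℝ d)}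

/-- **Window leaf measures charge no countable family of particles**: the configurations all of
whose particles lie in a given countable set form a leaf-null set (for `d ≥ 1`). Indeed the
corresponding window data range in a countable subset of the parameter space, null for the
Hausdorff measure of positive dimension. [folklore] -/
theorem windowLeafMeasure_setOf_coe_subset_eq_zero [Nonempty d] {C : Set 𝕏} (hC : C.Countable) :
    windowLeafMeasure Φ Λ ω {ω' | (ω' : Set 𝕏) ⊆ C} = 0 := by
  classical
  by_cases h : ω ∈ Φ.good ∧ (windowLabels Λ ω).Nonempty
  · rw [windowLeafMeasure_eq_map h.1 h.2,
      Measure.map_apply (measurable_implant Λ ω) (measurableSet_setOf_coe_subset hC.measurableSet)]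
    haveI := Measure.nullSingletonClass_hausdorff (↥(windowLabels Λ ω) → 𝕏)
      (windowUnstableDim_pos (d := d) (Finset.card_pos.2 h.2))
    have hsub : (fun y : ↥(windowLabels Λ ω) → 𝕏 => implant Λ ω y) ⁻¹' {ω' | (ω' : Set 𝕏) ⊆ C} ⊆
        Set.pi univ fun _ : ↥(windowLabels Λ ω) => C :=
      fun y hy i _ => hy (Or.inr (mem_range_self i))
    exact measure_mono_null hsub
      ((countable_univ_pi fun _ : ↥(windowLabels Λ ω) => hC).measure_zero _)
  · simp only [windowLeafMeasure, if_neg h, Measure.coe_zero, Pi.zero_apply]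

/-- **No Dirac leaves**: window leaf measures have no atoms (`d ≥ 1`). [folklore] -/
theorem windowLeafMeasure_singleton [Nonempty d] (ω' : PointConfig 𝕏) :
    windowLeafMeasure Φ Λ ω {ω'} = 0 :=
  measure_mono_null (fun _ h => by rw [mem_singleton_iff.1 h]; exact fun _ hp => hp)
    (windowLeafMeasure_setOf_coe_subset_eq_zero (countable_coe_pointConfig ω'))

/-- The leaf measures of the plaque functor charge no countable family of particles. [folklore] -/
theorem infiniteUnstablePlaques_leafMeasure_setOf_coe_subset_eq_zero [Nonempty d]
    (Φ : InfiniteHardSphereFlow d ε) (ω : PointConfig 𝕏) {C : Set 𝕏} (hC : C.Countable) :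
    (infiniteUnstablePlaques ε Φ).leafMeasure ω {ω' | (ω' : Set 𝕏) ⊆ C} = 0 := by
  rw [infiniteUnstablePlaques_leafMeasure, Measure.sum_apply_eq_zero]
  exact fun n => windowLeafMeasure_setOf_coe_subset_eq_zero hC

/-- **No Dirac leaves for the functor**: its leaf measures have no atoms (`d ≥ 1`). [folklore] -/
theorem infiniteUnstablePlaques_leafMeasure_singleton [Nonempty d] (Φ : InfiniteHardSphereFlow d ε)
    (ω ω' : PointConfig 𝕏) : (infiniteUnstablePlaques ε Φ).leafMeasure ω {ω'} = 0 :=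
  measure_mono_null (fun _ h => by rw [mem_singleton_iff.1 h]; exact fun _ hp => hp)
    (infiniteUnstablePlaques_leafMeasure_setOf_coe_subset_eq_zero Φ ω
      (countable_coe_pointConfig ω'))

end Measurability

/-! ## 7. The route's acceptance tests, as predicates on plaque functors -/

section Acceptance

/-- The **SANITY acceptance test** of route UGibbsSRBRigidity for a plaque functor `L` (typed
shape fixed by the planner): for some `z₀ > 0`, under every equilibrium flow of spheres of
diameter `1`, every translation-invariant hard-sphere Gibbs state of activity `z < z₀` is
`L`-u-regular — the infinite-volume analogue of "SRB measures have absolutely continuous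
conditional measures on unstable manifolds" (Ledrappier–Young 1985 Thm A; Pesin–Sinai 1982).
This is a PREDICATE on `L`; no source proves it for any `L` and it is NOT asserted here (the
route files `PlaqueSanity infiniteUnstablePlaques` as a support item). [folklore] -/
def PlaqueSanity (L : (ε : ℝ) → InfiniteHardSphereFlow d ε → PlaqueFamily (PointConfig 𝕏)) :
    Prop :=
  ∃ z₀ : ℝ, 0 < z₀ ∧ ∀ Φ : InfiniteHardSphereFlow d 1, Φ.IsEquilibriumFlow →
    ∀ (z β : ℝ) (u : 𝔼) (g : Measure (PointConfig 𝕏)), 0 < z → z < z₀ → 0 < β →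
      IsHardSphereGibbs 1 z β u g → IsTranslationInvariant g → (L 1 Φ).IsURegular g

/-- The **TEETH acceptance test** (frozen states) for a plaque functor `L`, in the form in which
it is a theorem for `infiniteUnstablePlaques` (`plaqueTeeth_infiniteUnstablePlaques`, file
`InfiniteUnstablePlaquesTeeth`): for every diameter `ε > 0` and every flow, a nonzero finite
STATIONARY law under which almost surely all particles share one velocity (a frozen state: no
collisions, no expansion) is not `L`-u-regular. Stationarity cannot be dropped: the recorded
pasts of configurations outside the support of the Gibbs states are not constrained by the
axioms of `InfiniteHardSphereFlow` (non-regular solutions, Alexander 1976 Cor. 5.4).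
[folklore] -/
def PlaqueTeeth (L : (ε : ℝ) → InfiniteHardSphereFlow d ε → PlaqueFamily (PointConfig 𝕏)) :
    Prop :=
  ∀ (ε : ℝ), 0 < ε → ∀ (Φ : InfiniteHardSphereFlow d ε) (μ : Measure (PointConfig 𝕏)),
    IsFiniteMeasure μ → μ ≠ 0 → Φ.IsStationary μ →
      (∀ᵐ ω ∂μ, ∀ p ∈ ω, ∀ q ∈ ω, p.2 = q.2) → ¬ (L ε Φ).IsURegular μ

end Acceptance

end Literature.Dynamics.Billiards
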